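import Literature.MathematicalPhysics.KineticTheory.HardSphereEulerProofs
import Literature.Analysis.FluidPDE.HardSphereDynamicsProofs
import HarnessLib

/-!
# `JParityClosure.KineticEnergyTails` (stmt-AtomisticToContinuum-13087): the a-priori half

Unconditional lemmas toward the support item `KineticEnergyTails` (uniform integrability of the
kinetic energy along the hard-sphere flow under the local Gibbs law). What energy conservation and
the Gaussian structure of the initial law DO give, on the tree's objects (`localGibbsLaw`,
`HardSphereFlow.flow`), for continuous profiles `a₀, θ₀ > 0`, `u₀` with `‖u₀‖ ≤ U`, `θ₀ ≤ Θ`: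

* `lintegral_meanVelObs_localGibbsMeasure_le` — disintegration bound for one-body velocity
  observables: if `∫ f dN(u₀(x), θ₀(x)) ≤ B` for every `x ∈ 𝕋³` then
  `𝔼_{λ^N}[(N+1)⁻¹ ∑ᵢ f(vᵢ)] ≤ B`, for every `σ` and `N` (conditionally on the positions the
  velocities are independent Gaussians, `lintegral_localGibbsMeasure`; the total mass is `≤ 1`).
* `lintegral_tailEnergy_flow_le` — THE `O(1)` BOUND ALONG THE FLOW: for every `σ`, `N`, flow `Φ`,
  cut-off `M` and time `s`,
  `𝔼_{λ^N}[(N+1)⁻¹ ∑ᵢ |vᵢ(Φ_s z)|² 𝟙{|vᵢ(Φ_s z)| > M}] ≤ U² + 3Θ`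
  (pathwise conservation of the kinetic energy on the good set,
  `IsHardSphereTrajectory.configEnergy_eq_holds`, which carries the law; then the second Gaussian
  moment `∫ |v|² dN(u, θ) = |u|² + 3θ`). This is the "tightness of the mean" that the grounders
  record as the only `N`-uniform dynamical information besides the (extensive) entropy bound; it
  does NOT decay in `M`.
* `tailEnergy_zero_le` / `exists_tailEnergy_zero_le` — AT TIME ZERO the item's bound holds, with
  the explicit rate `8 (U⁴ + Θ² K₄) / M²` (`K₄ = ∫ |w|⁴ dN(0, id)`), uniformly in `σ`, `N` and the
  flow (`Φ_0 = id` almost surely): Chebyshev on the fourth Gaussian moment.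

Nothing here closes the item: the missing input is the propagation of the time-zero smallness to
`s ∈ (0, t]` uniformly in `N`, an open a-priori estimate (see the reductions file
`JParityClosureKineticEnergyTails.lean` and `Literature.Barriers.AtomisticToContinuum.HighMomentumCutoff`).

References: Gallagher–Saint-Raymond–Texier, *From Newton to Boltzmann* (2013), §1.1 (energy);
H. Spohn, *Large Scale Dynamics of Interacting Particles* (1991), Part I §2.3 (local equilibrium).
-/

noncomputable section

namespace Summit.AtomisticToContinuum.HydrodynamicLimit.Theorems

open MeasureTheory ProbabilityTheory Set Filter
open scoped ENNReal BigOperators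
open Literature.MathematicalPhysics.KineticTheory Literature.Analysis.FluidPDE

/-! ### Gaussian velocity moments -/

/-- `|v|²` is integrable under the isotropic Gaussian `N(u, θ id)` on `ℝ³`. -/
theorem integrable_norm_sq_gaussMeasure (u : V3) (θ : ℝ) :
    Integrable (fun v : V3 => ‖v‖ ^ 2) (gaussMeasure u θ) :=
  (IsGaussian.memLp_id _ 2 (by simp)).integrable_norm_pow (by norm_num)

/-- `|v|⁴` is integrable under the isotropic Gaussian `N(u, θ id)` on `ℝ³`. -/
theorem integrable_norm_pow_four_gaussMeasure (u : V3) (θ : ℝ) :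
    Integrable (fun v : V3 => ‖v‖ ^ 4) (gaussMeasure u θ) :=
  (IsGaussian.memLp_id _ 4 (by simp)).integrable_norm_pow (by norm_num)

/-- The second moment of the isotropic Gaussian on `ℝ³`: `∫ |v|² dN(u, θ id) = |u|² + 3θ`
(`θ > 0`; from the centred identity `integral_energy_gaussMeasure`). -/
theorem integral_norm_sq_gaussMeasure (u : V3) {θ : ℝ} (hθ : 0 < θ) :
    ∫ v, ‖v‖ ^ 2 ∂gaussMeasure u θ = ‖u‖ ^ 2 + 3 * θ := by
  have h0 := integral_energy_gaussMeasure u hθ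
  have hsplit : ∫ v, (‖v‖ ^ 2 / 2 - ‖u‖ ^ 2 / 2 - Fintype.card (Fin 3) * θ / 2) ∂gaussMeasure u θ
      = (∫ v, ‖v‖ ^ 2 ∂gaussMeasure u θ) / 2 - ‖u‖ ^ 2 / 2 - 3 * θ / 2 := by
    rw [integral_sub, integral_sub, integral_const, integral_const]
    · simp only [probReal_univ, smul_eq_mul, one_mul, Fintype.card_fin, Nat.cast_ofNat]
      rw [integral_div]
    · exact (integrable_norm_sq_gaussMeasure u θ).div_const _
    · exact integrable_const _
    · exact ((integrable_norm_sq_gaussMeasure u θ).div_const _).sub (integrable_const _)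
    · exact integrable_const _
  rw [hsplit] at h0
  linarith

/-- The fourth moment of the isotropic Gaussian on `ℝ³` is at most `8 (|u|⁴ + θ² K₄)`,
`K₄ = ∫ |w|⁴ dN(0, id)` (`θ > 0`; triangle inequality and the power-mean bound
`(a + b)⁴ ≤ 8 (a⁴ + b⁴)` under the transfer identity `integral_gaussMeasure`). -/
theorem integral_norm_pow_four_gaussMeasure_le (u : V3) {θ : ℝ} (hθ : 0 < θ) :
    ∫ v, ‖v‖ ^ 4 ∂gaussMeasure u θ ≤
      8 * (‖u‖ ^ 4 + θ ^ 2 * ∫ w, ‖w‖ ^ 4 ∂stdGaussian V3) := by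
  rw [integral_gaussMeasure u hθ (fun v : V3 => ‖v‖ ^ 4)]
  -- power-mean: `(a + b)⁴ ≤ 8 (a⁴ + b⁴)` (also `Literature.Geometry.MetricEmbeddings.add_pow_four_le`)
  have h8 : ∀ a b : ℝ, (a + b) ^ 4 ≤ 8 * (a ^ 4 + b ^ 4) := fun a b => by
    nlinarith [sq_nonneg (a - b), sq_nonneg (a + b), sq_nonneg (a ^ 2 - b ^ 2),
      sq_nonneg (a ^ 2 + b ^ 2), mul_self_nonneg ((a - b) * (a + b))]
  have hpt : ∀ w : V3, ‖u + Real.sqrt θ • w‖ ^ 4 ≤ 8 * (‖u‖ ^ 4 + θ ^ 2 * ‖w‖ ^ 4) := by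
    intro w
    have h1 : ‖u + Real.sqrt θ • w‖ ≤ ‖u‖ + Real.sqrt θ * ‖w‖ := by
      calc ‖u + Real.sqrt θ • w‖ ≤ ‖u‖ + ‖Real.sqrt θ • w‖ := norm_add_le _ _
        _ = ‖u‖ + Real.sqrt θ * ‖w‖ := by
            rw [norm_smul, Real.norm_eq_abs, abs_of_nonneg (Real.sqrt_nonneg θ)]
    have h2 : ‖u + Real.sqrt θ • w‖ ^ 4 ≤ (‖u‖ + Real.sqrt θ * ‖w‖) ^ 4 :=
      pow_le_pow_left₀ (norm_nonneg _) h1 4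
    have h3 : (Real.sqrt θ * ‖w‖) ^ 4 = θ ^ 2 * ‖w‖ ^ 4 := by
      rw [mul_pow, show (4 : ℕ) = 2 * 2 from rfl, pow_mul, Real.sq_sqrt hθ.le]
    calc ‖u + Real.sqrt θ • w‖ ^ 4 ≤ (‖u‖ + Real.sqrt θ * ‖w‖) ^ 4 := h2
      _ ≤ 8 * (‖u‖ ^ 4 + (Real.sqrt θ * ‖w‖) ^ 4) := h8 _ _
      _ = 8 * (‖u‖ ^ 4 + θ ^ 2 * ‖w‖ ^ 4) := by rw [h3]
  have hint : Integrable (fun w : V3 => 8 * (‖u‖ ^ 4 + θ ^ 2 * ‖w‖ ^ 4)) (stdGaussian V3) :=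
    ((integrable_const _).add (integrable_norm_pow_four_stdGaussian.const_mul _)).const_mul _
  calc ∫ w, ‖u + Real.sqrt θ • w‖ ^ 4 ∂stdGaussian V3
      ≤ ∫ w, 8 * (‖u‖ ^ 4 + θ ^ 2 * ‖w‖ ^ 4) ∂stdGaussian V3 :=
        integral_mono_of_nonneg (Eventually.of_forall fun w => by positivity) hint
          (Eventually.of_forall hpt)
    _ = 8 * (‖u‖ ^ 4 + θ ^ 2 * ∫ w, ‖w‖ ^ 4 ∂stdGaussian V3) := by
        rw [integral_const_mul, integral_add (integrable_const _)
          (integrable_norm_pow_four_stdGaussian.const_mul _), integral_const, integral_const_mul]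
        simp

/-- The quadratic tail of the isotropic Gaussian on `ℝ³`, as a lower integral:
`∫ |v|² 𝟙{|v| > M} dN(u, θ id) ≤ 8 (|u|⁴ + θ² K₄) / M²` for `M > 0` (Chebyshev:
`|v|² 𝟙{|v| > M} ≤ |v|⁴ / M²`). -/
theorem lintegral_tail_gaussMeasure_le (u : V3) {θ : ℝ} (hθ : 0 < θ) {M : ℝ} (hM : 0 < M) :
    ∫⁻ v, ENNReal.ofReal (Set.indicator {w : V3 | M < ‖w‖} (fun w => ‖w‖ ^ 2) v)
        ∂gaussMeasure u θ ≤
      ENNReal.ofReal (8 * (‖u‖ ^ 4 + θ ^ 2 * ∫ w, ‖w‖ ^ 4 ∂stdGaussian V3) / M ^ 2) := by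
  have hpt : ∀ v : V3,
      Set.indicator {w : V3 | M < ‖w‖} (fun w => ‖w‖ ^ 2) v ≤ ‖v‖ ^ 4 / M ^ 2 := by
    intro v
    refine Set.indicator_apply_le' (fun hv => ?_) (fun _ => by positivity)
    have hv' : M < ‖v‖ := hv
    rw [le_div_iff₀ (by positivity)]
    calc ‖v‖ ^ 2 * M ^ 2 ≤ ‖v‖ ^ 2 * ‖v‖ ^ 2 :=
          mul_le_mul_of_nonneg_left (pow_le_pow_left₀ hM.le hv'.le 2) (sq_nonneg _)
      _ = ‖v‖ ^ 4 := by ring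
  calc ∫⁻ v, ENNReal.ofReal (Set.indicator {w : V3 | M < ‖w‖} (fun w => ‖w‖ ^ 2) v)
        ∂gaussMeasure u θ
      ≤ ∫⁻ v, ENNReal.ofReal (‖v‖ ^ 4 / M ^ 2) ∂gaussMeasure u θ :=
        lintegral_mono fun v => ENNReal.ofReal_le_ofReal (hpt v)
    _ = ENNReal.ofReal (∫ v, ‖v‖ ^ 4 / M ^ 2 ∂gaussMeasure u θ) := by
        rw [ofReal_integral_eq_lintegral_ofReal
          ((integrable_norm_pow_four_gaussMeasure u θ).div_const _)
          (Eventually.of_forall fun v => by positivity)]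
    _ ≤ ENNReal.ofReal (8 * (‖u‖ ^ 4 + θ ^ 2 * ∫ w, ‖w‖ ^ 4 ∂stdGaussian V3) / M ^ 2) := by
        refine ENNReal.ofReal_le_ofReal ?_
        rw [integral_div]
        exact div_le_div_of_nonneg_right (integral_norm_pow_four_gaussMeasure_le u hθ)
          (by positivity)

/-- The second moment of the isotropic Gaussian on `ℝ³`, as a lower integral:
`∫ |v|² dN(u, θ id) = |u|² + 3θ` in `ℝ≥0∞`. -/
theorem lintegral_norm_sq_gaussMeasure (u : V3) {θ : ℝ} (hθ : 0 < θ) :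
    ∫⁻ v, ENNReal.ofReal (‖v‖ ^ 2) ∂gaussMeasure u θ = ENNReal.ofReal (‖u‖ ^ 2 + 3 * θ) := by
  rw [← integral_norm_sq_gaussMeasure u hθ, ofReal_integral_eq_lintegral_ofReal
    (integrable_norm_sq_gaussMeasure u θ) (Eventually.of_forall fun v => by positivity)]
/-! ### Disintegration bound for one-body velocity observables -/

variable {a₀ θ₀ : T3 → ℝ} {u₀ : T3 → V3}

/-- Conditionally on the positions, the mean of a one-body velocity observable is bounded by its
worst single-Gaussian mean: if `∫ f dN(u₀(y), θ₀(y)) ≤ B` for all `y`, then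
`∫ (N+1)⁻¹ ∑ᵢ f(vᵢ) ⊗ᵢ N(u₀(xᵢ), θ₀(xᵢ))(dv) ≤ B` (`velMeasure` is the product law; marginals by
`measurePreserving_eval`). -/
theorem lintegral_meanVelObs_velMeasure_le {f : V3 → ℝ} (hf : Measurable f) (hf0 : ∀ v, 0 ≤ f v)
    {B : ℝ≥0∞} (hB : ∀ y : T3, ∫⁻ w, ENNReal.ofReal (f w) ∂gaussMeasure (u₀ y) (θ₀ y) ≤ B)
    {N : ℕ} (x : Fin (N + 1) → T3) :
    ∫⁻ v, ENNReal.ofReal (((N : ℝ) + 1)⁻¹ * ∑ i, f (v i)) ∂velMeasure u₀ θ₀ x ≤ B := by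
  have hsplit : ∀ v : Fin (N + 1) → V3, ENNReal.ofReal (((N : ℝ) + 1)⁻¹ * ∑ i, f (v i)) =
      ENNReal.ofReal (((N : ℝ) + 1)⁻¹) * ∑ i, ENNReal.ofReal (f (v i)) := by
    intro v
    rw [ENNReal.ofReal_mul (by positivity), ENNReal.ofReal_sum_of_nonneg (fun i _ => hf0 _)]
  have hmeas : ∀ i : Fin (N + 1),
      Measurable fun v : Fin (N + 1) → V3 => ENNReal.ofReal (f (v i)) := fun i =>
    (hf.comp (measurable_pi_apply i)).ennreal_ofReal
  have hterm : ∀ i : Fin (N + 1),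
      ∫⁻ v, ENNReal.ofReal (f (v i)) ∂velMeasure u₀ θ₀ x ≤ B := by
    intro i
    have hmp : MeasurePreserving (Function.eval i) (velMeasure u₀ θ₀ x)
        (gaussMeasure (u₀ (x i)) (θ₀ (x i))) := by
      unfold velMeasure
      exact measurePreserving_eval _ i
    have h := hmp.lintegral_comp (f := fun w : V3 => ENNReal.ofReal (f w)) hf.ennreal_ofReal
    calc ∫⁻ v, ENNReal.ofReal (f (v i)) ∂velMeasure u₀ θ₀ x
        = ∫⁻ w, ENNReal.ofReal (f w) ∂gaussMeasure (u₀ (x i)) (θ₀ (x i)) := h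
      _ ≤ B := hB (x i)
  simp_rw [hsplit]
  rw [lintegral_const_mul' _ _ ENNReal.ofReal_ne_top, lintegral_finsetSum' _
    (fun i _ => (hmeas i).aemeasurable)]
  calc ENNReal.ofReal (((N : ℝ) + 1)⁻¹) * ∑ i, ∫⁻ v, ENNReal.ofReal (f (v i)) ∂velMeasure u₀ θ₀ x
      ≤ ENNReal.ofReal (((N : ℝ) + 1)⁻¹) * ∑ _i : Fin (N + 1), B := by
        gcongr with i _
        exact hterm i
    _ = B := by
        rw [Finset.sum_const, Finset.card_univ, Fintype.card_fin, nsmul_eq_mul, ← mul_assoc]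
        have hN : (0 : ℝ) < (N : ℝ) + 1 := by positivity
        rw [ENNReal.ofReal_inv_of_pos hN, show ((N : ℝ) + 1) = ((N + 1 : ℕ) : ℝ) by push_cast; ring,
          ENNReal.ofReal_natCast, ENNReal.inv_mul_cancel (by simp) (ENNReal.natCast_ne_top _),
          one_mul]

/-- The total mass of the local Gibbs measure is at most one (it is `Z_pos⁻¹ · Z_pos`, i.e. `1` if
the spheres fit and `0` by the junk value of `canonicalDensity` otherwise). -/
theorem localGibbsMeasure_univ_le_one (ha : Continuous a₀) (hθ : Continuous θ₀) (hu : Continuous u₀)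
    (ha0 : ∀ x, 0 ≤ a₀ x) (hθ0 : ∀ x, 0 < θ₀ x) (σ : ℝ) (N : ℕ) :
    localGibbsMeasure σ a₀ u₀ θ₀ N univ ≤ 1 := by
  rw [localGibbsMeasure_univ ha hθ hu ha0 hθ0 σ N]
  set Z := posPartition a₀ (hsDiameter σ N) (N + 1) with hZ
  have hZ0 : 0 ≤ Z := posPartition_nonneg ha0 _ _
  rcases hZ0.eq_or_lt with h | h
  · rw [← h]
    simp
  · rw [← ENNReal.ofReal_mul (inv_nonneg.2 hZ0), inv_mul_cancel₀ h.ne', ENNReal.ofReal_one]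

/-- **Disintegration bound for one-body velocity observables under the local Gibbs measure.**
If `f ≥ 0` is measurable with `∫ f dN(u₀(y), θ₀(y)) ≤ B` for every `y ∈ 𝕋³`, then
`∫ (N+1)⁻¹ ∑ᵢ f(vᵢ) dλ^N ≤ B` for every `σ` and `N` (positions integrated out against a
sub-probability weight, `lintegral_localGibbsMeasure`). -/
theorem lintegral_meanVelObs_localGibbsMeasure_le (ha : Continuous a₀) (hθ : Continuous θ₀)
    (hu : Continuous u₀) (ha0 : ∀ x, 0 ≤ a₀ x) (hθ0 : ∀ x, 0 < θ₀ x)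
    {f : V3 → ℝ} (hf : Measurable f) (hf0 : ∀ v, 0 ≤ f v)
    {B : ℝ≥0∞} (hB : ∀ y : T3, ∫⁻ w, ENNReal.ofReal (f w) ∂gaussMeasure (u₀ y) (θ₀ y) ≤ B)
    (σ : ℝ) (N : ℕ) :
    ∫⁻ z, ENNReal.ofReal (((N : ℝ) + 1)⁻¹ * ∑ i, f ((z i).2)) ∂localGibbsMeasure σ a₀ u₀ θ₀ N
      ≤ B := by
  have hG : Measurable fun z : Config (N + 1) (Fin 3) T3 =>
      ENNReal.ofReal (((N : ℝ) + 1)⁻¹ * ∑ i, f ((z i).2)) :=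
    (measurable_const.mul (Finset.measurable_sum _ fun i _ =>
      hf.comp (measurable_pi_apply i).snd)).ennreal_ofReal
  rw [lintegral_localGibbsMeasure ha hθ hu ha0 hθ0 σ N hG]
  have hρm : Measurable fun x : Fin (N + 1) → T3 => ENNReal.ofReal
      ((canonicalPartition (Torus.geometry (Fin 3)) (hsDiameter σ N) (N + 1)
        (localGibbsProfile a₀ u₀ θ₀))⁻¹ * posWeight a₀ (hsDiameter σ N) (N + 1) x) :=
    (measurable_const.mul (measurable_posWeight ha _ _)).ennreal_ofReal
  have hmass : ∫⁻ x, ENNReal.ofReal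
      ((canonicalPartition (Torus.geometry (Fin 3)) (hsDiameter σ N) (N + 1)
        (localGibbsProfile a₀ u₀ θ₀))⁻¹ * posWeight a₀ (hsDiameter σ N) (N + 1) x) ≤ 1 := by
    have h := lintegral_localGibbsMeasure ha hθ hu ha0 hθ0 σ N (G := fun _ => 1) measurable_const
    simp only [lintegral_const, measure_univ, mul_one, one_mul] at h
    rw [← h]
    exact localGibbsMeasure_univ_le_one ha hθ hu ha0 hθ0 σ N
  calc ∫⁻ x, ENNReal.ofReal ((canonicalPartition (Torus.geometry (Fin 3)) (hsDiameter σ N) (N + 1)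
          (localGibbsProfile a₀ u₀ θ₀))⁻¹ * posWeight a₀ (hsDiameter σ N) (N + 1) x) *
          ∫⁻ v, ENNReal.ofReal (((N : ℝ) + 1)⁻¹ * ∑ i, f ((zipConfig (x, v) i).2))
            ∂velMeasure u₀ θ₀ x
      ≤ ∫⁻ x, ENNReal.ofReal ((canonicalPartition (Torus.geometry (Fin 3)) (hsDiameter σ N) (N + 1)
          (localGibbsProfile a₀ u₀ θ₀))⁻¹ * posWeight a₀ (hsDiameter σ N) (N + 1) x) * B := by
        refine lintegral_mono fun x => mul_le_mul' le_rfl ?_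
        simpa only [zipConfig_apply] using
          lintegral_meanVelObs_velMeasure_le (u₀ := u₀) (θ₀ := θ₀) hf hf0 hB x
    _ ≤ 1 * B := by
        rw [lintegral_mul_const _ hρm]
        exact mul_le_mul' hmass le_rfl
    _ = B := one_mul B
/-! ### Energy conservation carries the tail functional: the `O(1)` bound along the flow -/

/-- Pathwise: on the good set the quadratic tail sum at time `s` is below twice the (conserved)
kinetic energy, i.e. below `∑ᵢ |vᵢ(0)|²` (`IsHardSphereTrajectory.configEnergy_eq_holds`,
`HardSphereFlow.flow_zero`). -/
theorem tailSum_flow_le_energySum {ε : ℝ} {n : ℕ} (Φ : HardSphereFlow (Torus.geometry (Fin 3)) ε n)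
    {z : Config n (Fin 3) T3} (hz : z ∈ Φ.good) (M s : ℝ) :
    ∑ i, Set.indicator {v : V3 | M < ‖v‖} (fun v => ‖v‖ ^ 2) ((Φ.flow s z i).2) ≤
      ∑ i, ‖(z i).2‖ ^ 2 := by
  have hE : configEnergy (Φ.flow s z) = configEnergy z := by
    have h := IsHardSphereTrajectory.configEnergy_eq_holds (Φ.isTrajectory z hz) s 0
    simpa only [Φ.flow_zero z hz] using h
  have hsum : ∑ i, ‖(Φ.flow s z i).2‖ ^ 2 = ∑ i, ‖(z i).2‖ ^ 2 := by
    have h2 : (2 : ℝ) * configEnergy (Φ.flow s z) = 2 * configEnergy z := by rw [hE]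
    simpa [configEnergy] using h2
  calc ∑ i, Set.indicator {v : V3 | M < ‖v‖} (fun v => ‖v‖ ^ 2) ((Φ.flow s z i).2)
      ≤ ∑ i, ‖(Φ.flow s z i).2‖ ^ 2 := Finset.sum_le_sum fun i _ =>
          Set.indicator_apply_le' (fun _ => le_rfl) (fun _ => sq_nonneg _)
    _ = ∑ i, ‖(z i).2‖ ^ 2 := hsum

/-- In expectation: the tail functional at time `s` is dominated by the mean kinetic energy at
time `0` (the law is carried by the good set: it is absolutely continuous with respect to the
Liouville measure). No hypothesis on the profiles or on `σ`. -/
theorem lintegral_tailEnergy_flow_le_lintegral_energy (σ : ℝ) (a₀ : T3 → ℝ) (u₀ : T3 → V3)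
    (θ₀ : T3 → ℝ) (N : ℕ)
    (Φ : HardSphereFlow (Torus.geometry (Fin 3)) (hsDiameter σ N) (N + 1)) (M s : ℝ) :
    ∫⁻ z, ENNReal.ofReal (((N : ℝ) + 1)⁻¹ * ∑ i : Fin (N + 1),
        Set.indicator {v : V3 | M < ‖v‖} (fun v => ‖v‖ ^ 2) ((Φ.flow s z i).2))
        ∂(localGibbsLaw σ a₀ u₀ θ₀ N Φ) ≤
      ∫⁻ z, ENNReal.ofReal (((N : ℝ) + 1)⁻¹ * ∑ i : Fin (N + 1), ‖(z i).2‖ ^ 2)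
        ∂(localGibbsLaw σ a₀ u₀ θ₀ N Φ) := by
  refine lintegral_mono_ae ?_
  have hgood : ∀ᵐ z ∂localGibbsLaw σ a₀ u₀ θ₀ N Φ, z ∈ Φ.good := by
    rw [localGibbsLaw_eq]
    exact (localGibbsMeasure_absolutelyContinuous σ a₀ u₀ θ₀ N Φ).ae_le Φ.ae_mem_good
  filter_upwards [hgood] with z hz
  exact ENNReal.ofReal_le_ofReal
    (mul_le_mul_of_nonneg_left (tailSum_flow_le_energySum Φ hz M s) (by positivity))

/-- **The `O(1)` bound along the flow.** For continuous profiles `a₀ ≥ 0`, `θ₀ > 0`, `u₀` with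
`‖u₀‖ ≤ U` and `θ₀ ≤ Θ`, every `σ`, `N`, hard-sphere flow `Φ`, cut-off `M` and time `s`:
`𝔼_{λ^N}[(N+1)⁻¹ ∑ᵢ |vᵢ(Φ_s z)|² 𝟙{|vᵢ(Φ_s z)| > M}] ≤ U² + 3Θ` (energy conservation, then the
disintegration bound with `f = |·|²`, `∫ |v|² dN(u, θ) = |u|² + 3θ`). Uniform in everything,
but constant in `M`: energy conservation alone gives tightness of the mean, not uniform
integrability. -/
theorem lintegral_tailEnergy_flow_le (ha : Continuous a₀) (hθ : Continuous θ₀) (hu : Continuous u₀)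
    (ha0 : ∀ x, 0 ≤ a₀ x) (hθ0 : ∀ x, 0 < θ₀ x) {U Θ : ℝ} (hU : ∀ x, ‖u₀ x‖ ≤ U)
    (hΘ : ∀ x, θ₀ x ≤ Θ) (σ : ℝ) (N : ℕ)
    (Φ : HardSphereFlow (Torus.geometry (Fin 3)) (hsDiameter σ N) (N + 1)) (M s : ℝ) :
    ∫⁻ z, ENNReal.ofReal (((N : ℝ) + 1)⁻¹ * ∑ i : Fin (N + 1),
        Set.indicator {v : V3 | M < ‖v‖} (fun v => ‖v‖ ^ 2) ((Φ.flow s z i).2))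
        ∂(localGibbsLaw σ a₀ u₀ θ₀ N Φ) ≤ ENNReal.ofReal (U ^ 2 + 3 * Θ) := by
  refine (lintegral_tailEnergy_flow_le_lintegral_energy σ a₀ u₀ θ₀ N Φ M s).trans ?_
  rw [localGibbsLaw_eq]
  refine lintegral_meanVelObs_localGibbsMeasure_le ha hθ hu ha0 hθ0 (f := fun v : V3 => ‖v‖ ^ 2)
    (by fun_prop) (fun v => sq_nonneg _) (fun y => ?_) σ N
  rw [lintegral_norm_sq_gaussMeasure (u₀ y) (hθ0 y)]
  refine ENNReal.ofReal_le_ofReal ?_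
  have hUy : ‖u₀ y‖ ^ 2 ≤ U ^ 2 := pow_le_pow_left₀ (norm_nonneg _) (hU y) 2
  linarith [hΘ y]

/-- Existential form: for continuous profiles (`a₀ ≥ 0`, `θ₀ > 0`) there is ONE constant `K`
bounding the expected tail functional for all `σ`, `N`, flows, cut-offs and times (bounds `U`, `Θ`
exist by compactness of `𝕋³`). -/
theorem exists_lintegral_tailEnergy_flow_le (ha : Continuous a₀) (hθ : Continuous θ₀)
    (hu : Continuous u₀) (ha0 : ∀ x, 0 ≤ a₀ x) (hθ0 : ∀ x, 0 < θ₀ x) :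
    ∃ K : ℝ, ∀ (σ : ℝ) (N : ℕ)
      (Φ : HardSphereFlow (Torus.geometry (Fin 3)) (hsDiameter σ N) (N + 1)) (M s : ℝ),
      ∫⁻ z, ENNReal.ofReal (((N : ℝ) + 1)⁻¹ * ∑ i : Fin (N + 1),
          Set.indicator {v : V3 | M < ‖v‖} (fun v => ‖v‖ ^ 2) ((Φ.flow s z i).2))
          ∂(localGibbsLaw σ a₀ u₀ θ₀ N Φ) ≤ ENNReal.ofReal K := by
  obtain ⟨U, -, hU⟩ := exists_forall_abs_le_of_continuous (χ := fun x => ‖u₀ x‖) hu.norm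
  obtain ⟨Θ, -, hΘ⟩ := exists_forall_abs_le_of_continuous hθ
  refine ⟨U ^ 2 + 3 * Θ, fun σ N Φ M s => lintegral_tailEnergy_flow_le ha hθ hu ha0 hθ0
    (fun x => ?_) (fun x => (le_abs_self _).trans (hΘ x)) σ N Φ M s⟩
  have h := hU x
  rw [abs_of_nonneg (norm_nonneg _)] at h
  exact h

/-! ### At time zero the item's bound holds (Gaussian tails), uniformly in `σ`, `N`, `Φ` -/

/-- **Time-zero quadratic tails, explicit rate.** For continuous profiles `a₀ ≥ 0`, `θ₀ > 0`,
`u₀` with `‖u₀‖ ≤ U`, `θ₀ ≤ Θ`, every `σ`, `N`, flow `Φ` and cut-off `M > 0`: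
`𝔼_{λ^N}[(N+1)⁻¹ ∑ᵢ |vᵢ(Φ_0 z)|² 𝟙{|vᵢ(Φ_0 z)| > M}] ≤ 8 (U⁴ + Θ² K₄) / M²`,
`K₄ = ∫ |w|⁴ dN(0, id)` (`Φ_0 = id` almost surely; disintegration; Chebyshev on the fourth
Gaussian moment). -/
theorem tailEnergy_zero_le (ha : Continuous a₀) (hθ : Continuous θ₀) (hu : Continuous u₀)
    (ha0 : ∀ x, 0 ≤ a₀ x) (hθ0 : ∀ x, 0 < θ₀ x) {U Θ : ℝ} (hU : ∀ x, ‖u₀ x‖ ≤ U)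
    (hΘ : ∀ x, θ₀ x ≤ Θ) (σ : ℝ) (N : ℕ)
    (Φ : HardSphereFlow (Torus.geometry (Fin 3)) (hsDiameter σ N) (N + 1)) {M : ℝ} (hM : 0 < M) :
    ∫⁻ z, ENNReal.ofReal (((N : ℝ) + 1)⁻¹ * ∑ i : Fin (N + 1),
        Set.indicator {v : V3 | M < ‖v‖} (fun v => ‖v‖ ^ 2) ((Φ.flow 0 z i).2))
        ∂(localGibbsLaw σ a₀ u₀ θ₀ N Φ) ≤
      ENNReal.ofReal (8 * (U ^ 4 + Θ ^ 2 * ∫ w, ‖w‖ ^ 4 ∂stdGaussian V3) / M ^ 2) := by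
  have hΘ0 : 0 ≤ Θ := le_trans (hθ0 0).le (hΘ 0)
  -- `Φ_0 = id` almost surely
  have hgood : ∀ᵐ z ∂localGibbsLaw σ a₀ u₀ θ₀ N Φ, z ∈ Φ.good := by
    rw [localGibbsLaw_eq]
    exact (localGibbsMeasure_absolutelyContinuous σ a₀ u₀ θ₀ N Φ).ae_le Φ.ae_mem_good
  have hae : (fun z => ENNReal.ofReal (((N : ℝ) + 1)⁻¹ * ∑ i : Fin (N + 1),
        Set.indicator {v : V3 | M < ‖v‖} (fun v => ‖v‖ ^ 2) ((Φ.flow 0 z i).2))) =ᵐ[localGibbsLaw σ a₀ u₀ θ₀ N Φ]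
      (fun z => ENNReal.ofReal (((N : ℝ) + 1)⁻¹ * ∑ i : Fin (N + 1),
        Set.indicator {v : V3 | M < ‖v‖} (fun v => ‖v‖ ^ 2) ((z i).2))) := by
    filter_upwards [hgood] with z hz
    rw [Φ.flow_zero z hz]
  rw [lintegral_congr_ae hae, localGibbsLaw_eq]
  -- disintegration with `f = |·|² 𝟙{|·| > M}`
  have hK : 0 ≤ ∫ w, ‖w‖ ^ 4 ∂stdGaussian V3 := integral_nonneg fun w => by positivity
  refine lintegral_meanVelObs_localGibbsMeasure_le ha hθ hu ha0 hθ0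
    (f := Set.indicator {v : V3 | M < ‖v‖} (fun v => ‖v‖ ^ 2))
    ((measurable_norm.pow_const 2).indicator (measurableSet_lt measurable_const measurable_norm))
    (fun v => Set.indicator_nonneg (fun w _ => sq_nonneg _) v) (fun y => ?_) σ N
  refine (lintegral_tail_gaussMeasure_le (u₀ y) (hθ0 y) hM).trans (ENNReal.ofReal_le_ofReal ?_)
  have hUy : ‖u₀ y‖ ^ 4 ≤ U ^ 4 := pow_le_pow_left₀ (norm_nonneg _) (hU y) 4
  have hΘy : θ₀ y ^ 2 ≤ Θ ^ 2 := pow_le_pow_left₀ (hθ0 y).le (hΘ y) 2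
  gcongr

/-- **Time-zero quadratic tails, qualitative form: the item's bound holds at `s = 0`.** For
continuous profiles `a₀ ≥ 0`, `θ₀ > 0`, `u₀` and every `ε > 0` there is a cut-off `M` such that for
ALL `σ`, `N` and flows `Φ`,
`𝔼_{λ^N}[(N+1)⁻¹ ∑ᵢ |vᵢ(Φ_0 z)|² 𝟙{|vᵢ(Φ_0 z)| > M}] ≤ ε`. What the item asks in addition is the
propagation of this to `s ∈ (0, t]`, uniformly in `N` — the open part. -/
theorem exists_tailEnergy_zero_le (ha : Continuous a₀) (hθ : Continuous θ₀) (hu : Continuous u₀)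
    (ha0 : ∀ x, 0 ≤ a₀ x) (hθ0 : ∀ x, 0 < θ₀ x) {ε : ℝ} (hε : 0 < ε) :
    ∃ M : ℝ, ∀ (σ : ℝ) (N : ℕ)
      (Φ : HardSphereFlow (Torus.geometry (Fin 3)) (hsDiameter σ N) (N + 1)),
      ∫⁻ z, ENNReal.ofReal (((N : ℝ) + 1)⁻¹ * ∑ i : Fin (N + 1),
          Set.indicator {v : V3 | M < ‖v‖} (fun v => ‖v‖ ^ 2) ((Φ.flow 0 z i).2))
          ∂(localGibbsLaw σ a₀ u₀ θ₀ N Φ) ≤ ENNReal.ofReal ε := by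
  obtain ⟨U, -, hU⟩ := exists_forall_abs_le_of_continuous (χ := fun x => ‖u₀ x‖) hu.norm
  obtain ⟨Θ, -, hΘ⟩ := exists_forall_abs_le_of_continuous hθ
  have hU' : ∀ x, ‖u₀ x‖ ≤ U := fun x => by
    have h := hU x
    rwa [abs_of_nonneg (norm_nonneg _)] at h
  have hΘ' : ∀ x, θ₀ x ≤ Θ := fun x => (le_abs_self _).trans (hΘ x)
  set C : ℝ := 8 * (U ^ 4 + Θ ^ 2 * ∫ w, ‖w‖ ^ 4 ∂stdGaussian V3) with hC
  have hC0 : 0 ≤ C := by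
    have hK : 0 ≤ ∫ w, ‖w‖ ^ 4 ∂stdGaussian V3 := integral_nonneg fun w => by positivity
    positivity
  refine ⟨max 1 (C / ε), fun σ N Φ => ?_⟩
  have hM1 : 1 ≤ max 1 (C / ε) := le_max_left _ _
  have hM : 0 < max 1 (C / ε) := by positivity
  refine (tailEnergy_zero_le ha hθ hu ha0 hθ0 hU' hΘ' σ N Φ hM).trans (ENNReal.ofReal_le_ofReal ?_)
  rw [div_le_iff₀ (by positivity)]
  calc C = C / ε * ε := by field_simp
    _ ≤ max 1 (C / ε) * ε := mul_le_mul_of_nonneg_right (le_max_right _ _) hε.le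
    _ ≤ max 1 (C / ε) ^ 2 * ε := by
        refine mul_le_mul_of_nonneg_right ?_ hε.le
        calc max 1 (C / ε) = max 1 (C / ε) * 1 := (mul_one _).symm
          _ ≤ max 1 (C / ε) * max 1 (C / ε) := mul_le_mul_of_nonneg_left hM1 hM.le
          _ = max 1 (C / ε) ^ 2 := (sq _).symm
    _ = ε * max 1 (C / ε) ^ 2 := mul_comm _ _

end Summit.AtomisticToContinuum.HydrodynamicLimit.Theorems

end
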